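import Mathlib.Analysis.InnerProductSpace.Projection.Basic
import Mathlib.Analysis.InnerProductSpace.Symmetric
import HarnessLib

/-!
# Coincidence of the metric and the form projection on an invariant subspace

Analysis/OperatorTheory file (everything proved, no named facts). Let `E` be a real inner product
space, `A : E →ₗ[ℝ] E` symmetric (`⟪A u, v⟫ = ⟪u, A v⟫`), and `V ≤ E` a complete subspace invariant
under `A` (`A v ∈ V` for `v ∈ V`). Write `P = V.starProjection` for the orthogonal projection onto
`V` and `a(u, v) := ⟪A u, v⟫` for the (energy) form of `A`. Then

  `a(f − P f, v) = 0` for all `v ∈ V`,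

i.e. the metric orthogonal projection is ALSO the `a`-orthogonal projection: the orthogonal
complement `Vᗮ` is `a`-orthogonal to `V`. Proof: `⟪A (f − P f), v⟫ = ⟪f − P f, A v⟫ = 0` since
`f − P f ∈ Vᗮ` and `A v ∈ V`. Consequences recorded: the `a`-Pythagoras identity
`a(f, f) = a(P f, P f) + a(f − P f, f − P f)`, and the same statements with `V` spanned by a finite
family of eigenvectors of `A` (the typical way invariance arises).

## Why it is here (source and use)

Elementary linear algebra ([folklore]; e.g. Horn–Johnson 2013, §1.3 invariant subspaces / Kato 1980,
I-§5.3). It is the analytic residue "`I_N` is both the `L²(Ω)`- and the `E`-projection when `V_N` is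
spanned by the first `N` eigenfunctions of the free Rayleigh quotient" of the cell note
`pub-nsjs/pub-nsjs-typer/LEMMA-E.md` (E.1 step (a): `f^E_or ⊥_{L²(Ω)} V_N`, which is what makes
`‖Q^{1/2} f^E_or‖² ≤ K₅ ‖f^E_or‖²_E` available; Jia–Šverák programme, certified-enclosure lane; the
scheme is that of Hou–Wang–Yang, arXiv:2509.25116, which is under adjudication in that cell and is
NOT cited for this step). Here it is typed at the abstract level: a symmetric operator and an
invariant complete subspace; in the application `A` is the (Neumann) free energy operator on `Ω`,
whose form is `‖·‖²_E`, and `V_N` its span of low eigenfunctions. Nothing about Navier–Stokes is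
typed here.
-/

namespace Literature.Analysis.OperatorTheory

variable {E : Type*} [NormedAddCommGroup E] [InnerProductSpace ℝ E]

/-- **Metric projection is the form projection.** If `A` is symmetric and `V` is `A`-invariant,
then `f − P f` is `a`-orthogonal to `V` for the form `a(u, v) = ⟪A u, v⟫`. [folklore] -/
theorem inner_map_sub_starProjection_eq_zero (A : E →ₗ[ℝ] E) (hA : A.IsSymmetric)
    (V : Submodule ℝ E) [V.HasOrthogonalProjection] (hV : ∀ v ∈ V, A v ∈ V) (f : E) :
    ∀ v ∈ V, inner ℝ (A (f - V.starProjection f)) v = 0 := by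
  intro v hv
  rw [hA]
  exact Submodule.inner_left_of_mem_orthogonal (hV v hv)
    (Submodule.sub_starProjection_mem_orthogonal (K := V) f)

/-- The symmetric version: `⟪A v, f − P f⟫ = 0` for `v ∈ V`. [folklore] -/
theorem inner_map_starProjection_sub_eq_zero (A : E →ₗ[ℝ] E) (hA : A.IsSymmetric)
    (V : Submodule ℝ E) [V.HasOrthogonalProjection] (hV : ∀ v ∈ V, A v ∈ V) (f : E) :
    ∀ v ∈ V, inner ℝ (A v) (f - V.starProjection f) = 0 := by
  intro v hv
  rw [real_inner_comm, ← hA]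
  exact inner_map_sub_starProjection_eq_zero A hA V hV f v hv

/-- **Form-Pythagoras.** Under the same hypotheses the form of `A` splits along `V ⊕ Vᗮ`:
`a(f, f) = a(P f, P f) + a(f − P f, f − P f)`. [folklore] -/
theorem inner_map_self_eq_add_of_invariant (A : E →ₗ[ℝ] E) (hA : A.IsSymmetric)
    (V : Submodule ℝ E) [V.HasOrthogonalProjection] (hV : ∀ v ∈ V, A v ∈ V) (f : E) :
    inner ℝ (A f) f =
      inner ℝ (A (V.starProjection f)) (V.starProjection f)
        + inner ℝ (A (f - V.starProjection f)) (f - V.starProjection f) := by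
  set p := V.starProjection f with hp
  have hpV : p ∈ V := Submodule.starProjection_apply_mem V f
  have h1 : inner ℝ (A (f - p)) p = 0 :=
    inner_map_sub_starProjection_eq_zero A hA V hV f p hpV
  have h2 : inner ℝ (A p) (f - p) = 0 :=
    inner_map_starProjection_sub_eq_zero A hA V hV f p hpV
  have hf : f = p + (f - p) := by abel
  calc inner ℝ (A f) f
      = inner ℝ (A (p + (f - p))) (p + (f - p)) := by rw [← hf]
    _ = inner ℝ (A p) p + inner ℝ (A p) (f - p)
          + (inner ℝ (A (f - p)) p + inner ℝ (A (f - p)) (f - p)) := by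
        rw [map_add, inner_add_left, inner_add_right, inner_add_right]
    _ = inner ℝ (A p) p + inner ℝ (A (f - p)) (f - p) := by rw [h1, h2]; ring

/-- A subspace spanned by eigenvectors of `A` is `A`-invariant. [folklore] -/
theorem span_eigenvectors_invariant (A : E →ₗ[ℝ] E) {ι : Type*} (ψ : ι → E) (μ : ι → ℝ)
    (hψ : ∀ i, A (ψ i) = μ i • ψ i) :
    ∀ v ∈ Submodule.span ℝ (Set.range ψ), A v ∈ Submodule.span ℝ (Set.range ψ) := by
  intro v hv
  refine Submodule.span_induction (p := fun v _ => A v ∈ Submodule.span ℝ (Set.range ψ))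
    ?_ ?_ ?_ ?_ hv
  · rintro _ ⟨i, rfl⟩
    rw [hψ i]
    exact Submodule.smul_mem _ _ (Submodule.subset_span ⟨i, rfl⟩)
  · simp
  · intro x y _ _ hx hy
    rw [map_add]; exact Submodule.add_mem _ hx hy
  · intro c x _ hx
    rw [map_smul]; exact Submodule.smul_mem _ _ hx

/-- **The application shape.** For `V` spanned by eigenvectors `ψ_i` of a symmetric `A`, the
orthogonal projection onto `V` is also the `a`-projection: `⟪A (f − P f), v⟫ = 0` for `v ∈ V`.
[folklore] -/
theorem inner_map_sub_starProjection_span_eq_zero (A : E →ₗ[ℝ] E) (hA : A.IsSymmetric)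
    {ι : Type*} (ψ : ι → E) (μ : ι → ℝ) (hψ : ∀ i, A (ψ i) = μ i • ψ i)
    [(Submodule.span ℝ (Set.range ψ)).HasOrthogonalProjection] (f : E) :
    ∀ v ∈ Submodule.span ℝ (Set.range ψ),
      inner ℝ (A (f - (Submodule.span ℝ (Set.range ψ)).starProjection f)) v = 0 :=
  inner_map_sub_starProjection_eq_zero A hA _ (span_eigenvectors_invariant A ψ μ hψ) f

end Literature.Analysis.OperatorTheory
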